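import Literature.MathematicalPhysics.QuantumFieldTheory.CCHS2024.YMH3D
import HarnessLib

/-!
# Chandra–Chevyrev–Hairer–Shen: the DeTurck–Yang–Mills heat flow on `𝒮`, backwards uniqueness, and
# the space of gauge orbits `𝔒 = 𝒮/∼` in 3D (Invent. Math. 237 (2024), §§2.1–2.2, §2.6, Thm 1.2 (i)–(iii))

Cross-ladder literature typing (R141 (D) item (5), fifth file; venue `CCHS2024/`). STATEMENTS ONLY —
hypothesis-free definitions and the printed results as named `Prop`s; nothing here is a claim about
the Yang–Mills mass gap. Companion of `YMH3D.lean` (the state space `(𝒮, Σ)` on heat data, `ℐ`,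
`Θ`, the gauge group `𝔊^ρ`, the SPDE), whose renderings (R1)–(R4), (R12)–(R15) stay in force; in
particular this file is **pure Yang–Mills** (Higgs target `V = {0}`, R14). Source: A. Chandra,
I. Chevyrev, M. Hairer, H. Shen, *Stochastic quantisation of Yang–Mills–Higgs in 3D*, Invent. Math.
237 (2024) 541–696, arXiv:2201.03487 (held `paper:arxiv-2201.03487`; bib `ChandraEtAl2024`).
**Numbering.** Published numbering = one shared counter per section; the held TeX layer prints
per-kind counters. The §2 numbers used below were obtained by counting the 67 numbered environments
of §2 in the held text (Rem 2.1; §2.1: Def 2.2, L 2.3, Def 2.4, Rem 2.5–2.6, Def 2.7, Rem 2.8,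
Prop 2.9 "Well-posedness of YMH flow" (`prop:YM_flow_minus_heat`), Rem 2.10, Def 2.11
(`def:ymhflow`), Rem 2.12–2.14; §2.2: Prop 2.15 (`prop:back_unique`), Rem 2.16, L 2.17–2.20; §2.3:
Def 2.21–2.22, L 2.23–2.25; §2.4: Def 2.26 … L 2.38; §2.5: Thm 2.39 …; §2.6: Def 2.49, L 2.50,
Prop 2.51 (`prop:Hausdorff`), Rem 2.52, Prop 2.53; §2.7: L 2.54–2.56, Prop 2.57–2.58, …) and of §7
(Def 7.1, Def 7.2, Rem 7.3–7.4, Thm 7.5, Prop 7.6, Rem 7.7, L 7.8 (`lem:Sigmas_converg`), …); every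
cite below also names the item by its content / TeX label.

## The printed statements (pure YM: `E = 𝔤³`, no `Φ`)

* **Prop. 2.9 (well-posedness of the YMH flow).** Let `(η,β,δ)` satisfy (ℐ) and let `B = B_T` be the
  Banach space of `R ∈ C([0,T], C^{β̂})`, `β̂ = β + 2(1−δ)`, with
  `|R|_B = sup_{t∈(0,T)} (|R_t|_{C^{β̂}} + t^{−β̂/2}|R_t|_∞ + t^{1/2−β̂/2}|R_t|_{C¹}) < ∞`. For all
  `X ∈ ℐ` and `T ≲_{Θ(X)} 1` there is a unique `𝓡(X) ∈ B` such that `𝓕(X) = 𝓡(X) + 𝒫X : (0,T] → C^∞`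
  solves the flow `∂_t a_i = Δa_i + [a_j, 2∂_j a_i − ∂_i a_j + [a_j,a_i]]` (Rem. 2.10, pure YM) with
  `lim_{t→0} |𝓡_t(X)|_{C^{β̂}} = 0`; moreover `|𝓡(X)|_B ≲ ⟦X⟧_{β,δ} + 1` and `X ↦ 𝓡(X) ∈ B` is locally
  Lipschitz on `ℐ`. (`x ≲_K y` means `x ≤ C(K+1)^q y`, §2.)
* **Def. 2.11.** `𝓕(X)` on `(0, T_X)`, `T_X` the maximal existence time; `𝓕̃(X) : (0,∞) → 𝔒^∞`,
  `𝓕̃_t(X) = [𝓕_t(X)]` for `t ≤ T_X/2` and continued by the (global) flow without DeTurck term;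
  `X ∼ Y :⇔ 𝓕̃(X) = 𝓕̃(Y)` on `ℐ`. Rem. 2.13: `𝓕_t(X) ∈ 𝓕̃_t(X)` for all `t ∈ (0,T_X)`.
* **Prop. 2.15 (backwards uniqueness on gauge orbits).** `ρ ∈ (½,1]`, `X, Y ∈ Ω^ρ`: TFAE (i) `X ∼ Y`
  in `Ω^ρ` (`Y = X^g`, `g ∈ 𝔊^ρ`); (ii) `𝓕̃(X) = 𝓕̃(Y)`; (iii) `𝓕̃_t(X) = 𝓕̃_t(Y)` for some `t > 0`.
  Rem. 2.12: `∼` extends gauge equivalence of smooth functions.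
* **§2.6.** Def. 2.49: `𝔒 = 𝒮/∼`. Lemma 2.50: `{(X,Y) ∈ ℐ² : X ∼ Y}` is closed in `ℐ²`. Prop. 2.51:
  with the quotient topology `𝔒` is separable and completely Hausdorff. (= Thm 1.2 (iii).)
* **Lemma 7.8.** For every `x ∈ 𝒮`, `lim_{t→0} Σ(𝓕_t(x), x) = 0` (= Thm 1.2 (ii), last display; §5
  parameter regime).

## What is typed (print → Lean)

* `StateParams.betaHat`, `c1Norm3`, `flowRemainderNorm` (`|·|_{B_T}`), `heatNegSize` (`|X|_{C^ν}`,
  `ν < 0`, of a heat datum); the DeTurck–YM flow from a heat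
  datum as a classical PDE predicate `IsDeTurckYMFlow` (smooth on `(0,T) × 𝕋³`, the equation, the
  initial condition `|𝓕_t − 𝒫_t X|_{C^{β̂}} → 0`, membership of `𝓕 − 𝒫X` in `B_{T'}` for `T' < T`),
  maximality `IsMaximalDeTurckYMFlow` (`T = T_X`); smooth gauge equivalence `SmoothGaugeEquiv3`;
  **the orbit relation `OrbitRel3`** (`X ∼ Y`, R20) and the orbit `orbit3` (`[X] ∈ 𝔒`).
* Facts: `stateSpace3D_embedding` (Thm 1.2 (i)), `ymFlow_wellposed3D` (Prop 2.9), `backwardsUniqueness3D` (Prop 2.15 with Rem 2.12, smooth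
  data), `ymFlow_sigmaContinuous3D` (Lemma 7.8 = Thm 1.2 (ii)), `orbitRel3_closed` (Lemma 2.50),
  `orbitSpace3D` (Def 2.49 + Prop 2.51 = Thm 1.2 (iii): `∼` is an equivalence relation on `𝒮`, `𝔒`
  separable and completely Hausdorff).

## Renderings (recorded for the reviewer)

* (R12)–(R15) of `YMH3D.lean`: distributions on `𝕋³` are heat data `t ↦ 𝒫_t X`; negative Hölder
  sizes through the heat kernel (`negHolder`); pure YM; the §5 regime as `printedRegime ∧ nearCorner`.
  Prop 2.9 / Lemma 2.50 / Prop 2.51 are stated in print under condition (ℐ) (any `α, θ` for `𝒮`);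
  they are typed under (ℐ) together with `β̂ < 0` (so that `|·|_{C^{β̂}}` is the heat-kernel size of
  R12; in the §5 regime `β̂ < 0` holds) — a special case of the printed hypotheses.
* (R20) **The orbit relation.** Print defines `X ∼ Y :⇔ 𝓕̃(X) = 𝓕̃(Y)` (all `t > 0`) through the
  orbit-valued continuation `𝓕̃` built from the flow WITHOUT DeTurck term (Appendix A). Typed:
  `X ∼ Y :⇔` for some `t` smaller than both existence times, `𝓕_t(X)` and `𝓕_t(Y)` are gauge
  equivalent smooth fields (`OrbitRel3`). The two agree: "⇒" by Rem. 2.13 (`𝓕_t(X) ∈ 𝓕̃_t(X)` for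
  `t < T_X`); "⇐" since gauge equivalence at time `t` propagates forward along the gauge-covariant
  flow (proof of Prop 2.15, (i)⇒(ii)) and backward by Prop 2.15 (iii)⇒(i) applied to the smooth data
  `𝓕_s(X), 𝓕_s(Y)`, `s < t` (semigroup property) — so the typed relation is print's, by print's own
  Prop 2.15 and Rem 2.13; the flow without DeTurck term is therefore not transcribed. For SMOOTH
  `X, Y`, "`Y = X^g` for some `g ∈ 𝔊^ρ`" is typed with smooth `g` (for smooth `X, Y` any such `g` is
  smooth: `dg = gX − Yg`).
* (R21) "`T ≲_{Θ(X)} 1`" is typed literally with print's convention `x ≲_K y :⇔ x ≤ C(K+1)^q y`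
  (`∃ C > 0, q ∈ ℝ`); "locally Lipschitz" literally (a Lipschitz bound on a `Θ`-neighbourhood of each
  point, for every admissible common `T`); uniqueness in `B` as agreement of any two typed flows on
  their common interval. "Completely Hausdorff" = distinct orbits are separated by a `Σ`-continuous
  `∼`-invariant real function on `𝒮` (= a continuous function on the quotient); "separable" = a
  countable `D ⊆ 𝒮` meeting every non-empty saturated `Σ`-open subset of `𝒮`.

## Not transcribed

The flow without DeTurck term `ℰ` and Appendix A; Prop 2.15 for non-smooth `X, Y ∈ Ω^ρ`; §2.4
(the `𝔊^{0,ρ}`-action on `ℐ`, `X^g ∼ X`: `gaugeActionUniform3D` in `YMH3D.lean` is its dense case);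
§2.7 (compact embeddings), §2.8 (smoothened gauge-invariant observables separate `𝔒`);
§7 (Def 7.2 generative measures on `D(ℝ_+, 𝒮̂)` and Thm 7.5, the Markov process on `𝔒̂` — the 3D
analogue of `OrbitMarkov2D.lean`; `𝔒̂` is not Hausdorff, Prop 2.53); the author-stated open question
of §1.2 whether `∼` on `𝒮` is induced by the action of a gauge GROUP.
-/

noncomputable section

open MeasureTheory Filter Topology
open scoped ENNReal NNReal

namespace Literature.MathematicalPhysics.QuantumFieldTheory.CCHS2024

/-! ### The space `B_T` of Prop. 2.9 -/

section FlowSpace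

variable {N : ℕ}

/-- `β̂ = β + 2(1 − δ)`. [cite: ChandraEtAl2024, §2.1 Def. 2.7 (condition (ℐ): β̂ ≔ β + 2(1−δ))] -/
def StateParams.betaHat (p : StateParams) : ℝ := p.β + 2 * (1 - p.δ)

/-- `|F|_{C¹} = |F|_∞ + max_j |∂_j F|_∞` of a matrix field (extended, R3). [cite: ChandraEtAl2024, §1.3 (|f|_{C^α} for α > 0) and §2.1 Prop. 2.9 (the term t^{1/2−β̂/2}|R_t|_{C¹})] -/
def c1Norm3 (F : E3 → Matrix (Fin N) (Fin N) ℂ) : ℝ≥0∞ :=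
  supNorm3 F + ⨆ j : Fin 3, supNorm3 (pdX3 j F)

/-- **`|R|_{B_T} = sup_{t∈(0,T)} (|R_t|_{C^{β̂}} + t^{−β̂/2}|R_t|_∞ + t^{1/2−β̂/2}|R_t|_{C¹})`** for a
time-dependent field `R` (componentwise maxima; `|·|_{C^{β̂}}` by its heat-kernel size, `β̂ < 0`, R12).
[cite: ChandraEtAl2024, §2.1 Prop. 2.9 (the Banach space B and |R|_B)] -/
def flowRemainderNorm (bh : ℝ) (T : ℝ≥0∞) (R : TimeField3 N) : ℝ≥0∞ :=
  ⨆ (t : ℝ) (_ : 0 < t ∧ ENNReal.ofReal t < T), ⨆ i : Fin 3,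
    (negHolder bh (fun x => R t x i) +
      ENNReal.ofReal (t ^ (-bh / 2)) * supNorm3 (fun x => R t x i) +
      ENNReal.ofReal (t ^ (1 / 2 - bh / 2)) * c1Norm3 (fun x => R t x i))

/-- The heat-kernel size of negative index `ν` of a heat datum, `sup_{t∈(0,1)} t^{−ν/2} max_i ‖h_{t,i}‖_∞`
(`= |X|_{C^ν}` for `h = 𝒫X`, `ν < 0`, R12). [cite: ChandraEtAl2024, §1.3 (C^α(𝕋³,E), α < 0) and Thm 1.2 (i) (C^ν(𝕋³,E) ↪ 𝒮)] -/
def heatNegSize (ν : ℝ) (h : HeatDatum N) : ℝ≥0∞ :=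
  ⨆ (t : ℝ) (_ : t ∈ Set.Ioo (0 : ℝ) 1), ENNReal.ofReal (t ^ (-ν / 2)) * ⨆ i : Fin 3, supNorm3 (fun x => h t x i)

end FlowSpace

/-! ### The DeTurck–Yang–Mills heat flow from `X ∈ ℐ` and the orbit relation `∼` -/

section Flow

variable {G : Type*} [Group G] [TopologicalSpace G] (r : LatticeRep G)

/-- **`F = 𝓕(X)` on `(0,T)`, the DeTurck–YM heat flow from the heat datum `h = 𝒫X`** (pure YM):
`F` is smooth, periodic and `𝔤`-valued on `(0,T) × 𝕋³`,
`∂_t F_i = ΔF_i + ∑_j [F_j, 2∂_j F_i − ∂_i F_j + [F_j, F_i]]` there (Rem. 2.10 with `Φ = 0`), the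
initial condition holds in the sense of Prop. 2.9 — `R_t = F_t − 𝒫_t X → 0` in `C^{β̂}` as `t ↓ 0` —
and `R ∈ B_{T'}` for every `T' < T` (the uniqueness class of Prop. 2.9).
[cite: ChandraEtAl2024, §2.1 Prop. 2.9 (𝓕(X) ≔ 𝓡(X) + 𝒫X solves the YMH flow with DeTurck term, lim_{t→0}|𝓡_t(X)|_{C^{β̂}} = 0), Rem. 2.10 (the flow in coordinates) and Def. 2.11 (𝓕(X) on (0,T_X))] -/
def IsDeTurckYMFlow (p : StateParams) (h : HeatDatum r.N) (T : ℝ≥0∞) (F : TimeField3 r.N) : Prop :=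
  0 < T ∧
  (∀ (i : Fin 3) (c d : Fin r.N),
    ContDiffOn ℝ (⊤ : ℕ∞) (fun q : SpaceTime3 => F q.1 q.2 i c d) {q | 0 < q.1 ∧ ENNReal.ofReal q.1 < T}) ∧
  (∀ t : ℝ, 0 < t → ENNReal.ofReal t < T →
    (F t).IsPeriodic ∧ (F t).ValuedIn r.lieAlg ∧
    ∀ (x : E3) (i : Fin 3), pdT3 F t x i = laplacian3 (fun y => F t y i) x + symDrift3 (F t) i x) ∧
  (∀ i : Fin 3, Tendsto (fun t : ℝ => negHolder p.betaHat fun x => F t x i - h t x i) (𝓝[>] 0) (𝓝 0)) ∧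
  ∀ T' : ℝ, 0 < T' → ENNReal.ofReal T' < T → flowRemainderNorm p.betaHat (ENNReal.ofReal T') (F - h) < ∞

/-- `T = T_X` is the maximal existence time: no DeTurck–YM flow from the same datum lives on a longer
interval. [cite: ChandraEtAl2024, §2.1 Def. 2.11 ("T_X denotes the maximal existence time of the solution in C^∞(𝕋³,E)")] -/
def IsMaximalDeTurckYMFlow (p : StateParams) (h : HeatDatum r.N) (T : ℝ≥0∞) (F : TimeField3 r.N) :
    Prop :=
  IsDeTurckYMFlow r p h T F ∧ ∀ (T' : ℝ≥0∞) (F' : TimeField3 r.N), IsDeTurckYMFlow r p h T' F' → T' ≤ T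

/-- Gauge equivalence of smooth fields: `Y = X^g = (Ad_g X_i − (∂_i g)g⁻¹)_i` for a smooth
`g : 𝕋³ → G` (R20). [cite: ChandraEtAl2024, §1 eq. (1.5) and §2.2 (X ∼ X̄ in Ω^ρ: X̄ = X^g ≔ (Ad_g A − (dg)g⁻¹, gΦ); Rem. 2.12)] -/
def SmoothGaugeEquiv3 (X Y : Field3 r.N) : Prop :=
  ∃ g : E3 → G, IsPeriodicGauge3 g ∧ IsSmoothGauge3 r g ∧ Y = gaugeActField3 r g X

/-- **The orbit relation `X ∼ Y` on `ℐ ⊇ 𝒮`** (Def. 2.11: `𝓕̃(X) = 𝓕̃(Y)`), typed as: the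
DeTurck–YM flows of `X` and `Y` are gauge equivalent smooth fields at some time smaller than both
existence times (R20: equivalent to print's definition by Prop. 2.15 and Rem. 2.13).
[cite: ChandraEtAl2024, §2.1 Def. 2.11 (X ∼ Y ⇔ 𝓕̃(X) = 𝓕̃(Y)) with Rem. 2.13 and §2.2 Prop. 2.15] -/
def OrbitRel3 (p : StateParams) (h h' : HeatDatum r.N) : Prop :=
  ∃ (T T' : ℝ≥0∞) (F F' : TimeField3 r.N),
    IsDeTurckYMFlow r p h T F ∧ IsDeTurckYMFlow r p h' T' F' ∧
    ∃ t : ℝ, 0 < t ∧ ENNReal.ofReal t < T ∧ ENNReal.ofReal t < T' ∧ SmoothGaugeEquiv3 r (F t) (F' t)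

/-- The gauge orbit `[X] = {Y ∈ 𝒮 : Y ∼ X}`, a point of `𝔒 = 𝒮/∼`. [cite: ChandraEtAl2024, §2.1 Def. 2.11 ([X] the equivalence class of X) and §2.6 Def. 2.49 (𝔒 ≔ 𝒮/∼)] -/
def orbit3 (p : StateParams) (h : HeatDatum r.N) : Set (HeatDatum r.N) :=
  {h' | h' ∈ stateSpace3 r p ∧ OrbitRel3 r p h h'}

end Flow

/-! ### Proposition 2.9, Proposition 2.15, Lemma 7.8, Lemma 2.50, Proposition 2.51 -/

section Theorems

/-- **Theorem 1.2 (i) (embeddings), pure YM, §5 regime.** `𝒮 ↪ C^η` canonically (built into `Σ`: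
`Σ(X,0) ≥ |X|_{C^η}`), and there is `ν < 0` with `C^ν(𝕋³,E) ↪ 𝒮` densely: every (`𝔤³`-valued,
periodic) distribution of finite `C^ν`-size lies in `𝒮`, `C^ν`-convergence to such a limit implies
`Σ`-convergence (continuity of the inclusion; density is automatic, smooth fields being dense in `𝒮`),
and `𝒮` is closed under scalar multiplication.
[cite: ChandraEtAl2024, Thm 1.2 (i) ("See Lemmas 2.25 (lem:heatgr_Besov_embed) and 2.35 (lem:perturbation)(pt:fancynorm_0)", §2.3–§2.4)] -/
def stateSpace3D_embedding : Prop :=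
  ∀ (G : Type) [Group G] [TopologicalSpace G] [CompactSpace G] (r : LatticeRep G) (δ : ℝ),
    3 / 4 < δ → δ < 1 →
    ∃ ε₀ : ℝ, 0 < ε₀ ∧ ∀ p : StateParams, p.δ = δ → printedRegime p → nearCorner ε₀ p →
      ∃ ν : ℝ, ν < 0 ∧
        (∀ h : HeatDatum r.N, IsHeatFlow r.lieAlg h → heatNegSize ν h < ∞ → h ∈ stateSpace3 r p) ∧
        (∀ (X : ℕ → HeatDatum r.N) (h : HeatDatum r.N), (∀ n, IsHeatFlow r.lieAlg (X n)) →
          IsHeatFlow r.lieAlg h → heatNegSize ν h < ∞ →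
          Tendsto (fun n => heatNegSize ν (X n - h)) atTop (𝓝 0) →
          Tendsto (fun n => sigmaDist p (X n) h) atTop (𝓝 0)) ∧
        (∀ h ∈ stateSpace3 r p, ∀ c : ℝ, c • h ∈ stateSpace3 r p)

/-- **Proposition 2.9 (well-posedness of the DeTurck–YM(H) flow from `ℐ`), pure YM, `β̂ < 0`.** Let
`(η,β,δ)` satisfy (ℐ) with `β̂ < 0`. There are `C > 0`, `q ∈ ℝ` (print: "`T ≲_{Θ(X)} 1`", R21) and
`C' ≥ 0` such that for every `X ∈ ℐ` and every `0 < T ≤ C (Θ(X)+1)^q`: (existence) there is a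
DeTurck–YM flow `F` from `X` on `(0,T)` with `|F − 𝒫X|_{B_T} ≤ C'(⟦X⟧_{β,δ} + 1)`; (uniqueness in `B`)
any two flows from `X` agree on their common interval; (local Lipschitz continuity of `X ↦ 𝓡(X) ∈ B`)
every `X₀ ∈ ℐ` has a `Θ`-neighbourhood on which, for every `T` admissible for both data,
`|𝓡(X₁) − 𝓡(X₂)|_{B_T} ≤ L Θ(X₁, X₂)`.
[cite: ChandraEtAl2024, §2.1 Prop. 2.9 ("Well-posedness of YMH flow", prop:YM_flow_minus_heat) with Rem. 2.10; Thm 1.2 (ii)] -/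
def ymFlow_wellposed3D : Prop :=
  ∀ (G : Type) [Group G] [TopologicalSpace G] [CompactSpace G] (r : LatticeRep G) (p : StateParams),
    condI p → p.betaHat < 0 →
    ∃ (C q C' : ℝ), 0 < C ∧ 0 ≤ C' ∧
      -- existence with the bound `|𝓡(X)|_B ≲ ⟦X⟧ + 1`
      (∀ h ∈ initSpace3 r p, ∀ T : ℝ, 0 < T →
        T ≤ C * ((thetaDist p.η p.β p.δ h 0).toReal + 1) ^ q →
        ∃ F : TimeField3 r.N, IsDeTurckYMFlow r p h (ENNReal.ofReal T) F ∧
          flowRemainderNorm p.betaHat (ENNReal.ofReal T) (F - h) ≤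
            ENNReal.ofReal (C' * ((fancyDist p.β p.δ h 0).toReal + 1))) ∧
      -- uniqueness in the class `B`
      (∀ h ∈ initSpace3 r p, ∀ (T₁ T₂ : ℝ≥0∞) (F₁ F₂ : TimeField3 r.N),
        IsDeTurckYMFlow r p h T₁ F₁ → IsDeTurckYMFlow r p h T₂ F₂ →
        ∀ t : ℝ, 0 < t → ENNReal.ofReal t < T₁ → ENNReal.ofReal t < T₂ → F₁ t = F₂ t) ∧
      -- `X ↦ 𝓡(X) = 𝓕(X) − 𝒫X ∈ B` is locally Lipschitz on `(ℐ, Θ)`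
      (∀ h₀ ∈ initSpace3 r p, ∃ ε L : ℝ, 0 < ε ∧ 0 < L ∧
        ∀ h₁ ∈ initSpace3 r p, ∀ h₂ ∈ initSpace3 r p,
          thetaDist p.η p.β p.δ h₁ h₀ < ENNReal.ofReal ε → thetaDist p.η p.β p.δ h₂ h₀ < ENNReal.ofReal ε →
          ∀ T : ℝ, 0 < T → T ≤ C * ((thetaDist p.η p.β p.δ h₁ 0).toReal + 1) ^ q →
            T ≤ C * ((thetaDist p.η p.β p.δ h₂ 0).toReal + 1) ^ q →
          ∀ F₁ F₂ : TimeField3 r.N, IsDeTurckYMFlow r p h₁ (ENNReal.ofReal T) F₁ →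
            IsDeTurckYMFlow r p h₂ (ENNReal.ofReal T) F₂ →
            flowRemainderNorm p.betaHat (ENNReal.ofReal T) ((F₁ - h₁) - (F₂ - h₂)) ≤
              ENNReal.ofReal L * thetaDist p.η p.β p.δ h₁ h₂)

/-- **Proposition 2.15 (backwards uniqueness on gauge orbits) with Remark 2.12, smooth data.** Let
`(η,β,δ)` satisfy (ℐ) with `β̂ < 0` and let `X, Y` be smooth `𝔤³`-valued fields (print: `X, Y ∈ Ω^ρ`,
`ρ ∈ (½,1]`; the smooth case is typed, R20). Then: `X` and `Y` are gauge equivalent iff `X ∼ Y`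
("`∼` extends the usual notion of gauge equivalence"); and `X ∼ Y` iff `𝓕_t(X) ∼ 𝓕_t(Y)` for ALL times
`t` smaller than both existence times (print: (ii) `𝓕̃(X) = 𝓕̃(Y)` ⟺ (iii) for some `t > 0`).
[cite: ChandraEtAl2024, §2.2 Prop. 2.15 (prop:back_unique, (i)⇔(ii)⇔(iii)) with Rem. 2.12, Rem. 2.13, Rem. 2.16] -/
def backwardsUniqueness3D : Prop :=
  ∀ (G : Type) [Group G] [TopologicalSpace G] [CompactSpace G] (r : LatticeRep G) (p : StateParams),
    condI p → p.betaHat < 0 →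
    ∀ X ∈ smoothFields3 r, ∀ Y ∈ smoothFields3 r,
      (SmoothGaugeEquiv3 r X Y ↔ OrbitRel3 r p (heatOf X) (heatOf Y)) ∧
      (OrbitRel3 r p (heatOf X) (heatOf Y) ↔
        ∀ (T T' : ℝ≥0∞) (F F' : TimeField3 r.N),
          IsDeTurckYMFlow r p (heatOf X) T F → IsDeTurckYMFlow r p (heatOf Y) T' F' →
          ∀ t : ℝ, 0 < t → ENNReal.ofReal t < T → ENNReal.ofReal t < T' →
            SmoothGaugeEquiv3 r (F t) (F' t))

/-- **Lemma 7.8 (= Theorem 1.2 (ii), last display): `lim_{t→0} Σ(𝓕_t(x), x) = 0` for every `x ∈ 𝒮`**,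
in the parameter regime of §5 (R15; the proof uses `β̂ ≥ 2θ(α−1)` and `β̂ ≥ η̂`).
[cite: ChandraEtAl2024, §7.1 Lemma 7.8 (lem:Sigmas_converg) and Thm 1.2 (ii) (lim_{t→0} Σ(𝓕_t(X), X) = 0 for all X ∈ 𝒮); §5 (first paragraph)] -/
def ymFlow_sigmaContinuous3D : Prop :=
  ∀ (G : Type) [Group G] [TopologicalSpace G] [CompactSpace G] (r : LatticeRep G) (δ : ℝ),
    3 / 4 < δ → δ < 1 →
    ∃ ε₀ : ℝ, 0 < ε₀ ∧ ∀ p : StateParams, p.δ = δ → printedRegime p → nearCorner ε₀ p →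
      ∀ h ∈ stateSpace3 r p, ∀ (T : ℝ≥0∞) (F : TimeField3 r.N), IsDeTurckYMFlow r p h T F →
        Tendsto (fun t : ℝ => sigmaDist p (heatOf (F t)) h) (𝓝[>] 0) (𝓝 0)

/-- **Lemma 2.50.** For `(η,β,δ)` satisfying (ℐ) (`β̂ < 0`), the set `{(X,Y) ∈ ℐ² : X ∼ Y}` is closed
in `ℐ²`: if `X_n → X`, `Y_n → Y` in `(ℐ, Θ)` and `X_n ∼ Y_n` for all `n`, then `X ∼ Y`.
[cite: ChandraEtAl2024, §2.6 Lemma 2.50 (the set {(X,Y) ∈ ℐ² : X ∼ Y} is closed in ℐ²)] -/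
def orbitRel3_closed : Prop :=
  ∀ (G : Type) [Group G] [TopologicalSpace G] [CompactSpace G] (r : LatticeRep G) (p : StateParams),
    condI p → p.betaHat < 0 →
    ∀ (X Y : ℕ → HeatDatum r.N) (h h' : HeatDatum r.N),
      (∀ n, X n ∈ initSpace3 r p) → (∀ n, Y n ∈ initSpace3 r p) →
      h ∈ initSpace3 r p → h' ∈ initSpace3 r p →
      Tendsto (fun n => thetaDist p.η p.β p.δ (X n) h) atTop (𝓝 0) →
      Tendsto (fun n => thetaDist p.η p.β p.δ (Y n) h') atTop (𝓝 0) →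
      (∀ n, OrbitRel3 r p (X n) (Y n)) → OrbitRel3 r p h h'

/-- **Definition 2.49 and Proposition 2.51 (= Theorem 1.2 (iii)): the orbit space `𝔒 = 𝒮/∼` is
separable and completely Hausdorff.** For `(η,β,δ)` satisfying (ℐ) (`β̂ < 0`) and any `α, θ`: `∼` is
an equivalence relation on `𝒮`; distinct orbits are separated by a `Σ`-continuous `∼`-invariant real
function on `𝒮` (completely Hausdorff quotient); and there is a countable `D ⊆ 𝒮` meeting every
non-empty saturated `Σ`-open subset of `𝒮` (separable quotient) (R21).
[cite: ChandraEtAl2024, §2.6 Def. 2.49 (𝔒 ≔ 𝒮/∼) and Prop. 2.51 (prop:Hausdorff: "With the quotient topology, 𝔒 is separable and completely Hausdorff"); Thm 1.2 (iii)] -/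
def orbitSpace3D : Prop :=
  ∀ (G : Type) [Group G] [TopologicalSpace G] [CompactSpace G] (r : LatticeRep G) (p : StateParams),
    condI p → p.betaHat < 0 →
    -- `∼` is an equivalence relation on `𝒮`
    (∀ h ∈ stateSpace3 r p, OrbitRel3 r p h h) ∧
    (∀ h ∈ stateSpace3 r p, ∀ h' ∈ stateSpace3 r p, OrbitRel3 r p h h' → OrbitRel3 r p h' h) ∧
    (∀ h ∈ stateSpace3 r p, ∀ h' ∈ stateSpace3 r p, ∀ h'' ∈ stateSpace3 r p,
      OrbitRel3 r p h h' → OrbitRel3 r p h' h'' → OrbitRel3 r p h h'') ∧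
    -- completely Hausdorff
    (∀ h ∈ stateSpace3 r p, ∀ h' ∈ stateSpace3 r p, ¬ OrbitRel3 r p h h' →
      ∃ f : HeatDatum r.N → ℝ,
        (∀ x ∈ stateSpace3 r p, ∀ y ∈ stateSpace3 r p, OrbitRel3 r p x y → f x = f y) ∧
        (∀ x ∈ stateSpace3 r p, ∀ ε : ℝ, 0 < ε → ∃ η₁ : ℝ, 0 < η₁ ∧ ∀ y ∈ stateSpace3 r p,
          sigmaDist p x y < ENNReal.ofReal η₁ → |f x - f y| < ε) ∧
        f h ≠ f h') ∧
    -- separable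
    (∃ D : Set (HeatDatum r.N), D.Countable ∧ D ⊆ stateSpace3 r p ∧
      ∀ U : Set (HeatDatum r.N), U ⊆ stateSpace3 r p → U.Nonempty →
        (∀ x ∈ U, ∀ y ∈ stateSpace3 r p, OrbitRel3 r p x y → y ∈ U) →
        (∀ x ∈ U, ∃ ε : ℝ, 0 < ε ∧ ∀ y ∈ stateSpace3 r p, sigmaDist p x y < ENNReal.ofReal ε → y ∈ U) →
        ∃ d ∈ D, d ∈ U)

end Theorems

end Literature.MathematicalPhysics.QuantumFieldTheory.CCHS2024
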